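import Literature.NumberTheory.Automorphic.GLnAdelicStructure
import Literature.NumberTheory.Automorphic.AdeleRingTopology
import HarnessLib

/-!
# The idempotent `e_S ∈ 𝔸_K` of a finite set of finite places

Topic `NumberTheory/Automorphic`; one small definition with body (`adelePlacesIdem`) and theorems;
no named fact, no instance.

For a finite set `S` of finite places of a number field `K`, `e_S ∈ 𝔸_K` is the adele with
component `1` at the places of `S` and `0` at all other places (finite and infinite): the sum of
the single-place adeles `adeleSingleHom K v 1` (`GLnAdelicStructure`). It is an idempotent, and
`𝔸_K = e_S 𝔸_K × (1 - e_S) 𝔸_K` is the decomposition `𝔸_K = K_S × 𝔸_K^S` into the `S`-part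
`K_S = Π_{v ∈ S} K_v` and the adeles away from `S` (Cassels–Fröhlich, Ch. II §14; Bump (1997), §3.3;
Gelbart (1975), §10, p. 153, "`G_𝔸 = G_S × G^S`"):

* `adelePlacesIdem K S = e_S`; `adeleEval_adelePlacesIdem` (components), `adelePlacesIdem_fst`
  (archimedean component `0`), `isIdempotentElem_adelePlacesIdem`;
* `AdeleRing.ext'` — two adeles agree iff their archimedean parts and all their finite components
  agree;
* `adelePlacesIdem_mul_eq_mul_iff` — `e_S x = e_S y` iff `x_v = y_v` for `v ∈ S`;
  `one_sub_adelePlacesIdem_mul_eq_mul_iff` — `(1 - e_S) x = (1 - e_S) y` iff `x_∞ = y_∞` and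
  `x_w = y_w` for `w ∉ S`;
* `adelePlacesIdem_mul_adeleSingleHom_of_mem/_of_not_mem` — `e_S ι_v(x) = ι_v(x)` (`v ∈ S`),
  `= 0` (`v ∉ S`);
* `adeleSingleHom_mul` (`ι_v(x) a = ι_v(x a_v)`), `mul_adeleSingleHom`, `adeleSingleHom_smul` — the
  single-place inclusion `ι_v : K_v → 𝔸_K` (`adeleSingleHom`, `GLnAdelicStructure`) sees only the
  `v`-component and is compatible with the `K`-actions (its `K`-linear packaging is the tree's
  `adeleSingleLinear` of `JacquetLanglands`; `e_v a = ι_v(a_v)` is the tree's `adeleSingleHom_one_mul`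
  of `JacquetLanglandsParts`).

Multiplication by `e_S ⊗ 1`, `e_S · 1_n` are then the central idempotents along which
`(𝔸_K ⊗_K D)ˣ` and `GL_n(𝔸_K)` split as `G_S × G^S`
(`Literature.Topology.Algebra.unitsContinuousEquivCornerUnitsProd`). Part of the inline (D-0026)
decomposition of `Literature.NumberTheory.Automorphic.strong_multiplicity_one_quaternionUnits`.

## References

* J. W. S. Cassels, A. Fröhlich (eds.), *Algebraic Number Theory* (1967), Ch. II §14
  [CasselsFrohlichANT1967].
* D. Bump, *Automorphic Forms and Representations* (1997), §3.3 [Bump1997].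
* S. Gelbart, *Automorphic forms on adele groups* (1975), §10, p. 153 [Gelbart1975].
-/

noncomputable section

open NumberField IsDedekindDomain

namespace Literature.NumberTheory.Automorphic

section Idempotent

variable (K : Type) [Field K] [NumberField K]

/-- **Two adeles agree iff their archimedean parts and all finite components agree.** [folklore] -/
theorem AdeleRing.ext' {x y : AdeleRing (𝓞 K) K} (h₁ : x.1 = y.1)
    (h₂ : ∀ w : HeightOneSpectrum (𝓞 K), AdelicGroupData.adeleEval K w x = AdelicGroupData.adeleEval K w y) :
    x = y :=
  Prod.ext h₁ (FiniteAdeleRing.ext K h₂)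

/-- Archimedean part of a product of adeles (definitional; private copies of the tree's
`fst_mul_adele` / `AdeleRing.zero_fst` family, to keep imports light). [folklore] -/
private theorem AdeleRing.fst_mul (x y : AdeleRing (𝓞 K) K) : (x * y).1 = x.1 * y.1 := rfl

/-- Archimedean part of a sum of adeles (definitional). [folklore] -/
private theorem AdeleRing.fst_add (x y : AdeleRing (𝓞 K) K) : (x + y).1 = x.1 + y.1 := rfl

/-- Archimedean part of `1` (definitional). [folklore] -/
private theorem AdeleRing.fst_one : (1 : AdeleRing (𝓞 K) K).1 = 1 := rfl

/-- Archimedean part of `0` (definitional). [folklore] -/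
private theorem AdeleRing.fst_zero : (0 : AdeleRing (𝓞 K) K).1 = 0 := rfl

/-- **The idempotent `e_S ∈ 𝔸_K` of a finite set `S` of finite places**: component `1` at `v ∈ S`,
`0` elsewhere (the sum over `v ∈ S` of the single-place adeles `ι_v(1)`; Cassels–Fröhlich II §14).
[folklore] -/
def adelePlacesIdem (S : Finset (HeightOneSpectrum (𝓞 K))) : AdeleRing (𝓞 K) K :=
  ∑ v ∈ S, adeleSingleHom K v 1

/-- The archimedean component of `e_S` is `0`. [folklore] -/
@[simp]
theorem adelePlacesIdem_fst (S : Finset (HeightOneSpectrum (𝓞 K))) : (adelePlacesIdem K S).1 = 0 := by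
  classical
  unfold adelePlacesIdem
  induction S using Finset.induction_on with
  | empty => rfl
  | @insert v S hv ih => rw [Finset.sum_insert hv, AdeleRing.fst_add, ih, adeleSingleHom_apply_fst, add_zero]

open scoped Classical in
/-- The components of `e_S`: `1` at `w ∈ S`, `0` at `w ∉ S`. [folklore] -/
theorem adeleEval_adelePlacesIdem (S : Finset (HeightOneSpectrum (𝓞 K))) (w : HeightOneSpectrum (𝓞 K)) :
    AdelicGroupData.adeleEval K w (adelePlacesIdem K S) = if w ∈ S then 1 else 0 := by
  unfold adelePlacesIdem
  induction S using Finset.induction_on with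
  | empty => rw [Finset.sum_empty, map_zero, if_neg (Finset.notMem_empty w)]
  | @insert v S hv ih =>
    rw [Finset.sum_insert hv, map_add, ih]
    by_cases h : w = v
    · subst h
      rw [adeleEval_adeleSingleHom, if_neg hv, if_pos (Finset.mem_insert_self w S), add_zero]
    · rw [adeleEval_adeleSingleHom_of_ne K v 1 h, zero_add]
      by_cases hw : w ∈ S
      · rw [if_pos hw, if_pos (Finset.mem_insert_of_mem hw)]
      · rw [if_neg hw, if_neg (by simp [Finset.mem_insert, h, hw])]

variable {K}

/-- `(e_S)_w = 1` for `w ∈ S`. [folklore] -/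
theorem adeleEval_adelePlacesIdem_of_mem {S : Finset (HeightOneSpectrum (𝓞 K))} {w : HeightOneSpectrum (𝓞 K)}
    (hw : w ∈ S) : AdelicGroupData.adeleEval K w (adelePlacesIdem K S) = 1 := by
  classical
  rw [adeleEval_adelePlacesIdem, if_pos hw]

/-- `(e_S)_w = 0` for `w ∉ S`. [folklore] -/
theorem adeleEval_adelePlacesIdem_of_not_mem {S : Finset (HeightOneSpectrum (𝓞 K))} {w : HeightOneSpectrum (𝓞 K)}
    (hw : w ∉ S) : AdelicGroupData.adeleEval K w (adelePlacesIdem K S) = 0 := by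
  classical
  rw [adeleEval_adelePlacesIdem, if_neg hw]

/-- **`e_S` is an idempotent.** [folklore] -/
theorem isIdempotentElem_adelePlacesIdem (S : Finset (HeightOneSpectrum (𝓞 K))) :
    IsIdempotentElem (adelePlacesIdem K S) := by
  classical
  refine AdeleRing.ext' K (by rw [AdeleRing.fst_mul, adelePlacesIdem_fst, mul_zero]) fun w => ?_
  rw [map_mul, adeleEval_adelePlacesIdem]
  split_ifs <;> simp

/-- `e_{{v}} = ι_v(1)`. [folklore] -/
theorem adelePlacesIdem_singleton (v : HeightOneSpectrum (𝓞 K)) :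
    adelePlacesIdem K {v} = adeleSingleHom K v 1 :=
  Finset.sum_singleton _ _

/-- **`e_S x = e_S y` iff `x` and `y` have the same components at the places of `S`.** [folklore] -/
theorem adelePlacesIdem_mul_eq_mul_iff {S : Finset (HeightOneSpectrum (𝓞 K))} {x y : AdeleRing (𝓞 K) K} :
    adelePlacesIdem K S * x = adelePlacesIdem K S * y ↔
      ∀ v ∈ S, AdelicGroupData.adeleEval K v x = AdelicGroupData.adeleEval K v y := by
  constructor
  · intro h v hv
    have h' := congrArg (AdelicGroupData.adeleEval K v) h
    rwa [map_mul, map_mul, adeleEval_adelePlacesIdem_of_mem hv, one_mul, one_mul] at h'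
  · intro h
    refine AdeleRing.ext' K (by rw [AdeleRing.fst_mul, AdeleRing.fst_mul, adelePlacesIdem_fst, zero_mul, zero_mul])
      fun w => ?_
    rw [map_mul, map_mul]
    by_cases hw : w ∈ S
    · rw [h w hw]
    · rw [adeleEval_adelePlacesIdem_of_not_mem hw, zero_mul, zero_mul]

/-- `e_S x = 0` iff `x_v = 0` for `v ∈ S`. [folklore] -/
theorem adelePlacesIdem_mul_eq_zero_iff {S : Finset (HeightOneSpectrum (𝓞 K))} {x : AdeleRing (𝓞 K) K} :
    adelePlacesIdem K S * x = 0 ↔ ∀ v ∈ S, AdelicGroupData.adeleEval K v x = 0 := by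
  rw [← mul_zero (adelePlacesIdem K S), adelePlacesIdem_mul_eq_mul_iff]
  simp only [map_zero]

/-- **`(1 - e_S) x = (1 - e_S) y` iff `x` and `y` have the same archimedean part and the same
components away from `S`.** [folklore] -/
theorem one_sub_adelePlacesIdem_mul_eq_mul_iff {S : Finset (HeightOneSpectrum (𝓞 K))} {x y : AdeleRing (𝓞 K) K} :
    (1 - adelePlacesIdem K S) * x = (1 - adelePlacesIdem K S) * y ↔
      x.1 = y.1 ∧ ∀ w ∉ S, AdelicGroupData.adeleEval K w x = AdelicGroupData.adeleEval K w y := by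
  constructor
  · intro h
    refine ⟨?_, fun w hw => ?_⟩
    · have h' := congrArg Prod.fst h
      rwa [AdeleRing.fst_mul, AdeleRing.fst_mul, AdeleRing.fst_sub, AdeleRing.fst_one, adelePlacesIdem_fst,
        sub_zero, one_mul, one_mul] at h'
    · have h' := congrArg (AdelicGroupData.adeleEval K w) h
      rwa [map_mul, map_mul, map_sub, map_one, adeleEval_adelePlacesIdem_of_not_mem hw, sub_zero, one_mul,
        one_mul] at h'
  · rintro ⟨h₁, h₂⟩
    refine AdeleRing.ext' K ?_ fun w => ?_
    · rw [AdeleRing.fst_mul, AdeleRing.fst_mul, h₁]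
    · rw [map_mul, map_mul, map_sub, map_one]
      by_cases hw : w ∈ S
      · rw [adeleEval_adelePlacesIdem_of_mem hw, sub_self, zero_mul, zero_mul]
      · rw [h₂ w hw]

/-- `(1 - e_S) x = 0` iff `x_∞ = 0` and `x_w = 0` for `w ∉ S`. [folklore] -/
theorem one_sub_adelePlacesIdem_mul_eq_zero_iff {S : Finset (HeightOneSpectrum (𝓞 K))} {x : AdeleRing (𝓞 K) K} :
    (1 - adelePlacesIdem K S) * x = 0 ↔
      x.1 = 0 ∧ ∀ w ∉ S, AdelicGroupData.adeleEval K w x = 0 := by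
  rw [← mul_zero (1 - adelePlacesIdem K S), one_sub_adelePlacesIdem_mul_eq_mul_iff, AdeleRing.fst_zero]
  simp only [map_zero]

/-- `e_S ι_v(x) = ι_v(x)` for `v ∈ S`. [folklore] -/
theorem adelePlacesIdem_mul_adeleSingleHom_of_mem {S : Finset (HeightOneSpectrum (𝓞 K))}
    {v : HeightOneSpectrum (𝓞 K)} (hv : v ∈ S) (x : v.adicCompletion K) :
    adelePlacesIdem K S * adeleSingleHom K v x = adeleSingleHom K v x := by
  refine AdeleRing.ext' K (by rw [AdeleRing.fst_mul, adelePlacesIdem_fst, zero_mul, adeleSingleHom_apply_fst])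
    fun w => ?_
  rw [map_mul]
  by_cases hw : w = v
  · subst hw
    rw [adeleEval_adelePlacesIdem_of_mem hv, one_mul]
  · rw [adeleEval_adeleSingleHom_of_ne K v x hw, mul_zero]

/-- `e_S ι_v(x) = 0` for `v ∉ S`. [folklore] -/
theorem adelePlacesIdem_mul_adeleSingleHom_of_not_mem {S : Finset (HeightOneSpectrum (𝓞 K))}
    {v : HeightOneSpectrum (𝓞 K)} (hv : v ∉ S) (x : v.adicCompletion K) :
    adelePlacesIdem K S * adeleSingleHom K v x = 0 := by
  refine AdeleRing.ext' K (by rw [AdeleRing.fst_mul, adelePlacesIdem_fst, zero_mul, AdeleRing.fst_zero]) fun w => ?_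
  rw [map_mul, map_zero]
  by_cases hw : w = v
  · subst hw
    rw [adeleEval_adelePlacesIdem_of_not_mem hv, zero_mul]
  · rw [adeleEval_adeleSingleHom_of_ne K v x hw, mul_zero]

/-- `(1 - e_S) ι_v(x) = 0` for `v ∈ S`. [folklore] -/
theorem one_sub_adelePlacesIdem_mul_adeleSingleHom_of_mem {S : Finset (HeightOneSpectrum (𝓞 K))}
    {v : HeightOneSpectrum (𝓞 K)} (hv : v ∈ S) (x : v.adicCompletion K) :
    (1 - adelePlacesIdem K S) * adeleSingleHom K v x = 0 := by
  rw [sub_mul, one_mul, adelePlacesIdem_mul_adeleSingleHom_of_mem hv, sub_self]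

open scoped Classical in
/-- The components of `e_S x`: `x_v` at `v ∈ S`, `0` elsewhere. [folklore] -/
theorem adeleEval_adelePlacesIdem_mul {S : Finset (HeightOneSpectrum (𝓞 K))} (x : AdeleRing (𝓞 K) K)
    (w : HeightOneSpectrum (𝓞 K)) :
    AdelicGroupData.adeleEval K w (adelePlacesIdem K S * x) =
      if w ∈ S then AdelicGroupData.adeleEval K w x else 0 := by
  rw [map_mul, adeleEval_adelePlacesIdem]
  split_ifs <;> simp

end Idempotent

/-! ### Single-place adeles: `K`-linearity and the multiplication rules `ι_v(x) a = ι_v(x a_v)` -/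

section Single

variable (K : Type) [Field K] [NumberField K] (v : HeightOneSpectrum (𝓞 K))

/-- The `v`-component of the principal adele of `x ∈ K` is the image of `x` in `K_v` (a private copy
of `AdelicGroupData.adeleEval_algebraMap` of `GL2EllipticSplitPlaceLocal`, to keep the imports of this
file light). [folklore] -/
private theorem adeleEval_algebraMap' (x : K) :
    AdelicGroupData.adeleEval K v (algebraMap K (AdeleRing (𝓞 K) K) x) = algebraMap K (v.adicCompletion K) x := by
  rw [AdelicGroupData.adeleEval_apply]
  change algebraMap K (FiniteAdeleRing (𝓞 K) K) x v = _
  rw [FiniteAdeleRing.algebraMap_apply]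
  exact adicCompletion_coe_eq_algebraMap (𝓞 K) K v x

variable {K v} in
/-- **`ι_v(x) a = ι_v(x a_v)`**: a single-place adele sees only the `v`-component of the other
factor. [folklore] -/
theorem adeleSingleHom_mul (x : v.adicCompletion K) (a : AdeleRing (𝓞 K) K) :
    adeleSingleHom K v x * a = adeleSingleHom K v (x * AdelicGroupData.adeleEval K v a) := by
  refine AdeleRing.ext' K (by rw [AdeleRing.fst_mul, adeleSingleHom_apply_fst, adeleSingleHom_apply_fst, zero_mul])
    fun w => ?_
  rw [map_mul]
  by_cases hw : w = v
  · subst hw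
    rw [adeleEval_adeleSingleHom, adeleEval_adeleSingleHom]
  · rw [adeleEval_adeleSingleHom_of_ne K v _ hw, adeleEval_adeleSingleHom_of_ne K v _ hw, zero_mul]

variable {K v} in
/-- `a ι_v(x) = ι_v(a_v x)`. [folklore] -/
theorem mul_adeleSingleHom (a : AdeleRing (𝓞 K) K) (x : v.adicCompletion K) :
    a * adeleSingleHom K v x = adeleSingleHom K v (AdelicGroupData.adeleEval K v a * x) := by
  rw [mul_comm, adeleSingleHom_mul, mul_comm]

variable {K v} in
/-- `ι_v` is compatible with the `K`-actions: `ι_v(k x) = k ι_v(x)`. [folklore] -/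
theorem adeleSingleHom_smul (k : K) (x : v.adicCompletion K) :
    adeleSingleHom K v (k • x) = k • adeleSingleHom K v x := by
  rw [Algebra.smul_def, Algebra.smul_def, mul_adeleSingleHom, adeleEval_algebraMap']

end Single

end Literature.NumberTheory.Automorphic
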